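import Summits.ValiantsHypothesis.ValiantsHypothesis.Theorems.DivisionGapPerDivisionHardStubRookRigid
import Summits.ValiantsHypothesis.ValiantsHypothesis.Theorems.DivisionGapPerDivisionHardStubGreedyRooks
import Summits.ValiantsHypothesis.ValiantsHypothesis.Theorems.DivisionGapPerDivisionHardStubTorusSupport
import Summits.ValiantsHypothesis.ValiantsHypothesis.Theorems.DivisionGapPerDivisionHardStubFaceDescent
import Summits.ValiantsHypothesis.ValiantsHypothesis.Theorems.DivisionGapPerDivisionHardStubJssContraction
import Summits.ValiantsHypothesis.ValiantsHypothesis.Theorems.DivisionGapPerDivisionHardStubBlockArsenal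
import Summits.ValiantsHypothesis.ValiantsHypothesis.Theorems.DivisionGapPerDivisionHardSparseGraph

/-!
# Crux `DivisionGap.PerDivisionHard` (stmt-ValiantsHypothesis-5065), line `pair-descent-jss-endpoint` —
the ROOK-CONSTANT rung (skeleton v15, chapter RIGID CELLS, part A)

`PerDivisionHard` asks: for every `c`, for all large `n`, every nonzero `h ∈ ℝ≥0[x_ij]` has
`2^{(log₂ n + c)^c} < L(per_n · h) + L(h)`.  This file proves it UNCONDITIONALLY for every cofactor
whose monomials AGREE on a set of at least `(log₂ n + d)^d` cells in ROOK POSITION — pairwise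
distinct rows and pairwise distinct columns, e.g. that many diagonal cells —
(`perDivisionHard_rookConstant`, `d = d(c)`), hence for every cofactor whose monomials agree on ANY
`2n(log₂ n + d)^d` cells (`perDivisionHard_cellsConstant`: a cell set of that size contains the rooks,
greedily — `stub_greedyRooks`) and for every cofactor avoiding that many of the `n²` variables
(`perDivisionHard_cellsAvoided`).  The rows-constant / columns-constant rung of
`Theorems/DivisionGapPerDivisionHardRowsAvoided.lean` is the special case of `q` whole lines.

Mechanism (`stub_rookRigid`).  Place the `b²` doubly-internal cells `(row (i,j,0), col (i,j,0))` of
the block arsenal `G(b,1) ⊕ M₀`, `b = (log₂ n + d₀)^{d₀}`, ON the rooks.  After the torus normal form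
(`stub_torusSupport`: a sub-support, so still constant on the rooks) the generic cut exposes the
placed face and its top fibre agrees off the face; two fibre monomials have equal margins and agree
on the rooks, so their difference is a circulation of the placed graph vanishing on the middle cell
of every path — it is zero (`stub_midRigid`).  Hence the fibre is ONE monomial, and face descent
(`stub_faceDescent`), JSS contraction (`stub_jssContraction`) and the hardness of the placed face
(`stub_blockArsenal`) finish exactly as in the skeleton's composition.  Purely local: no girth, no
counting over placements.

What it says about the residual cofactor of the crux: the set of cells on which it is constant
contains no `(log₂ n + d)^d` rooks, i.e. (Kőnig) is covered by fewer than `(log₂ n + d)^d` lines; in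
particular an undecided cofactor VARIES on — and uses — all but `2n·(log₂ n + d)^d` of the `n²`
variables.
-/

noncomputable section

-- `Summit.ValiantsHypothesis.ValiantsHypothesis.…` is the tree's mandated single-conjunct layout
-- (Sub = Summit), so the duplicated namespace component is intended.
set_option linter.dupNamespace false

namespace Summit.ValiantsHypothesis.ValiantsHypothesis.Theorems.DivisionGapPerDivisionHard

open MvPolynomial Literature.Computability.AlgebraicComplexity
open scoped NNReal

/-- **The ROOK-CONSTANT rung of `PerDivisionHard`.**  For every `c` there are `d, n₀` such that for
all `n ≥ n₀` and every nonzero `h ∈ ℝ≥0[x_ij]`: if the monomials of `h` agree on a set `P` of at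
least `(log₂ n + d)^d` cells in rook position (no two in a row, no two in a column), then
`2^{(log₂ n+c)^c} < L(per_n·h) + L(h)`.  Torus normal form (sub-support, still constant on `P`),
rigidity (`stub_rookRigid`), face descent, JSS contraction, the placed face is harder. -/
theorem perDivisionHard_rookConstant :
    ∀ c : ℕ, ∃ d n₀ : ℕ, ∀ n ≥ n₀, ∀ h : MvPolynomial (Fin n × Fin n) ℝ≥0, h ≠ 0 →
      ∀ P : Finset (Fin n × Fin n), (Nat.log 2 n + d) ^ d ≤ P.card →
      Set.InjOn Prod.fst (P : Set (Fin n × Fin n)) → Set.InjOn Prod.snd (P : Set (Fin n × Fin n)) →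
      (∀ m₁ ∈ h.support, ∀ m₂ ∈ h.support, ∀ e ∈ P, m₁ e = m₂ e) →
      2 ^ ((Nat.log 2 n + c) ^ c) < complexity (perPoly (Fin n) ℝ≥0 * h) + complexity h := by
  intro c
  obtain ⟨κ, hcon⟩ := stub_jssContraction
  obtain ⟨d, n₁, hhard⟩ := stub_blockArsenal c κ
  obtain ⟨n₀, hS⟩ := stub_rookRigid d
  refine ⟨d + d, n₀ + n₁, ?_⟩
  intro n hn h hh P hP hfst hsnd hconst
  obtain ⟨h', hh', htor, hsupp, hle1, -⟩ := stub_torusSupport n h hh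
  by_contra hlt
  have hle : complexity (perPoly (Fin n) ℝ≥0 * h) + complexity h ≤
      2 ^ ((Nat.log 2 n + c) ^ c) := not_lt.mp hlt
  have hP' : (Nat.log 2 n + d) ^ d * (Nat.log 2 n + d) ^ d ≤ P.card := by
    refine le_trans ?_ hP
    rw [← pow_add]
    exact Nat.pow_le_pow_left (by omega) _
  have hconst' : ∀ m₁ ∈ h'.support, ∀ m₂ ∈ h'.support, ∀ e ∈ P, m₁ e = m₂ e :=
    fun m₁ hm₁ m₂ hm₂ e he => hconst m₁ (hsupp hm₁) m₂ (hsupp hm₂) e he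
  obtain ⟨b, k, m, eR, eC, w, u, hb, hcut, hsingle⟩ :=
    hS n (by omega) h' hh' htor P hP' hfst hsnd hconst'
  have hdesc := stub_faceDescent n (placedBlock eR eC) w h' u hcut hh' hsingle
  have h1 : complexity (monomial u (1 : ℝ≥0) * facePer (placedBlock eR eC)) ≤
      2 ^ ((Nat.log 2 n + c) ^ c) + 1 :=
    calc complexity (monomial u (1 : ℝ≥0) * facePer (placedBlock eR eC))
        ≤ complexity (perPoly (Fin n) ℝ≥0 * h') + 1 := hdesc
      _ ≤ complexity (perPoly (Fin n) ℝ≥0 * h) + 1 := Nat.add_le_add_right hle1 1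
      _ ≤ 2 ^ ((Nat.log 2 n + c) ^ c) + 1 :=
          Nat.add_le_add_right (le_trans (Nat.le_add_right _ _) hle) 1
  have h2 : complexity (facePer (placedBlock eR eC)) ≤
      ((n + 2) * (2 ^ ((Nat.log 2 n + c) ^ c) + 3)) ^ κ :=
    calc complexity (facePer (placedBlock eR eC))
        ≤ ((n + 2) * (complexity (monomial u (1 : ℝ≥0) * facePer (placedBlock eR eC)) + 2)) ^ κ :=
          hcon n (facePer (placedBlock eR eC)) u
      _ ≤ ((n + 2) * (2 ^ ((Nat.log 2 n + c) ^ c) + 3)) ^ κ :=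
          Nat.pow_le_pow_left (Nat.mul_le_mul_left _ (by omega)) κ
  have h3 := hhard n (by omega) b k m eR eC hb
  exact absurd (lt_of_lt_of_le h3 h2) (lt_irrefl _)

/-- **The CELLS-CONSTANT rung of `PerDivisionHard`.**  For every `c` there are `d, n₀` such that for
all `n ≥ n₀` and every nonzero `h`: if the monomials of `h` agree on a set `Z` of at least
`2n(log₂ n + d)^d` cells — ANY cells — then `2^{(log₂ n+c)^c} < L(per_n·h) + L(h)` (greedy rooks
inside `Z`, `stub_greedyRooks`, then `perDivisionHard_rookConstant`).  Contains the rows-constant and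
columns-constant rungs (`q` whole lines are `qn` cells). -/
theorem perDivisionHard_cellsConstant :
    ∀ c : ℕ, ∃ d n₀ : ℕ, ∀ n ≥ n₀, ∀ h : MvPolynomial (Fin n × Fin n) ℝ≥0, h ≠ 0 →
      ∀ Z : Finset (Fin n × Fin n), 2 * n * (Nat.log 2 n + d) ^ d ≤ Z.card →
      (∀ m₁ ∈ h.support, ∀ m₂ ∈ h.support, ∀ e ∈ Z, m₁ e = m₂ e) →
      2 ^ ((Nat.log 2 n + c) ^ c) < complexity (perPoly (Fin n) ℝ≥0 * h) + complexity h := by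
  intro c
  obtain ⟨d, n₀, hrook⟩ := perDivisionHard_rookConstant c
  obtain ⟨n₂, hgrow⟩ := four_mul_logPow_le d
  refine ⟨d, n₀ + n₂, fun n hn h hh Z hZ hconst => ?_⟩
  have hN : (Nat.log 2 n + d) ^ d ≤ n :=
    le_trans (Nat.le_mul_of_pos_left _ (by norm_num)) (hgrow n (by omega))
  obtain ⟨P, hPZ, hPcard, hfst, hsnd⟩ := stub_greedyRooks n ((Nat.log 2 n + d) ^ d) Z hN hZ
  exact hrook n (by omega) h hh P hPcard.ge hfst hsnd
    fun m₁ hm₁ m₂ hm₂ e he => hconst m₁ hm₁ m₂ hm₂ e (hPZ he)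

/-- **The CELLS-AVOIDED corollary: a cofactor in at most `n² - 2n(log₂ n + d)^d` of the variables
never helps.**  For every `c` there are `d, n₀` such that for all `n ≥ n₀` and every nonzero `h`: if
no monomial of `h` touches a cell set `Z` with `|Z| ≥ 2n(log₂ n + d)^d`, then
`2^{(log₂ n+c)^c} < L(per_n·h) + L(h)`. -/
theorem perDivisionHard_cellsAvoided :
    ∀ c : ℕ, ∃ d n₀ : ℕ, ∀ n ≥ n₀, ∀ h : MvPolynomial (Fin n × Fin n) ℝ≥0, h ≠ 0 →
      ∀ Z : Finset (Fin n × Fin n), 2 * n * (Nat.log 2 n + d) ^ d ≤ Z.card →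
      (∀ m ∈ h.support, ∀ e ∈ m.support, e ∉ Z) →
      2 ^ ((Nat.log 2 n + c) ^ c) < complexity (perPoly (Fin n) ℝ≥0 * h) + complexity h := by
  intro c
  obtain ⟨d, n₀, H⟩ := perDivisionHard_cellsConstant c
  refine ⟨d, n₀, fun n hn h hh Z hZ havoid => H n hn h hh Z hZ fun m₁ hm₁ m₂ hm₂ e he => ?_⟩
  have h1 : m₁ e = 0 := by
    by_contra hne
    exact havoid m₁ hm₁ e (Finsupp.mem_support_iff.mpr hne) he
  have h2 : m₂ e = 0 := by
    by_contra hne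
    exact havoid m₂ hm₂ e (Finsupp.mem_support_iff.mpr hne) he
  rw [h1, h2]

/-- **Pair interface of the rook-constant rung** (for descent-type transfers): the crux inequality for
`(h, h')` as soon as `h'` is nonzero, torus-homogeneous, constant on `(log₂ n + d)^d` rooks and no
more expensive than `h` on the `per`-side. -/
theorem two_pow_lt_pair_of_rookConstant (c : ℕ) :
    ∃ d n₀ : ℕ, ∀ n ≥ n₀, ∀ h h' : MvPolynomial (Fin n × Fin n) ℝ≥0, h' ≠ 0 → IsTorusHomogeneous h' →
      complexity (perPoly (Fin n) ℝ≥0 * h') ≤ complexity (perPoly (Fin n) ℝ≥0 * h) →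
      ∀ P : Finset (Fin n × Fin n), (Nat.log 2 n + d) ^ d ≤ P.card →
      Set.InjOn Prod.fst (P : Set (Fin n × Fin n)) → Set.InjOn Prod.snd (P : Set (Fin n × Fin n)) →
      (∀ m₁ ∈ h'.support, ∀ m₂ ∈ h'.support, ∀ e ∈ P, m₁ e = m₂ e) →
      2 ^ ((Nat.log 2 n + c) ^ c) < complexity (perPoly (Fin n) ℝ≥0 * h) + complexity h := by
  obtain ⟨κ, hcon⟩ := stub_jssContraction
  obtain ⟨d, n₁, hhard⟩ := stub_blockArsenal c κ
  obtain ⟨n₀, hS⟩ := stub_rookRigid d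
  refine ⟨d + d, n₀ + n₁, ?_⟩
  intro n hn h h' hh' htor hle1 P hP hfst hsnd hconst
  by_contra hlt
  have hle : complexity (perPoly (Fin n) ℝ≥0 * h) + complexity h ≤
      2 ^ ((Nat.log 2 n + c) ^ c) := not_lt.mp hlt
  have hP' : (Nat.log 2 n + d) ^ d * (Nat.log 2 n + d) ^ d ≤ P.card := by
    refine le_trans ?_ hP
    rw [← pow_add]
    exact Nat.pow_le_pow_left (by omega) _
  obtain ⟨b, k, m, eR, eC, w, u, hb, hcut, hsingle⟩ :=
    hS n (by omega) h' hh' htor P hP' hfst hsnd hconst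
  have hdesc := stub_faceDescent n (placedBlock eR eC) w h' u hcut hh' hsingle
  have h1 : complexity (monomial u (1 : ℝ≥0) * facePer (placedBlock eR eC)) ≤
      2 ^ ((Nat.log 2 n + c) ^ c) + 1 :=
    calc complexity (monomial u (1 : ℝ≥0) * facePer (placedBlock eR eC))
        ≤ complexity (perPoly (Fin n) ℝ≥0 * h') + 1 := hdesc
      _ ≤ complexity (perPoly (Fin n) ℝ≥0 * h) + 1 := Nat.add_le_add_right hle1 1
      _ ≤ 2 ^ ((Nat.log 2 n + c) ^ c) + 1 :=
          Nat.add_le_add_right (le_trans (Nat.le_add_right _ _) hle) 1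
  have h2 : complexity (facePer (placedBlock eR eC)) ≤
      ((n + 2) * (2 ^ ((Nat.log 2 n + c) ^ c) + 3)) ^ κ :=
    calc complexity (facePer (placedBlock eR eC))
        ≤ ((n + 2) * (complexity (monomial u (1 : ℝ≥0) * facePer (placedBlock eR eC)) + 2)) ^ κ :=
          hcon n (facePer (placedBlock eR eC)) u
      _ ≤ ((n + 2) * (2 ^ ((Nat.log 2 n + c) ^ c) + 3)) ^ κ :=
          Nat.pow_le_pow_left (Nat.mul_le_mul_left _ (by omega)) κ
  have h3 := hhard n (by omega) b k m eR eC hb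
  exact absurd (lt_of_lt_of_le h3 h2) (lt_irrefl _)

end Summit.ValiantsHypothesis.ValiantsHypothesis.Theorems.DivisionGapPerDivisionHard

end
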